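import Summits.AnomalousDissipation.AnomalousDissipation.Theorems.SolenoidalFractalHomogenisationLagrangianStepCellLawVQSResp
import HarnessLib

/-!
# K1L `LagrangianRenormalisationStep(Design)` (K1L_D, stmt-AnomalousDissipation-27980; aside 24912), stub `stub_cellLawV0_IS`
# — W3: SLOT LAPLACE TRANSFORMS — the ramp bound (P1), the cross-slot factorisation (P2), the ramp transform `Jmat` and the PAIR response
# `J_X(B) J_{X'}(B)` with their Loewner pinches (helper; `--supports stmt-AnomalousDissipation-27980`; word-independent)

Summits-side helper file of route `SolenoidalFractalHomogenisation` (planner ad-ideate-p5's STUB-PLAN for `stub_cellLawV` §1; `SlowGraphSketch.lean` P1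
`RampLaplaceBound` / P2 `PairFactorisation` / `Jmat` / `pairQS`; tenure WORKER FIT v2 item W3; director-frontier K-AD-L3), on top of `…CellLawVSemigroupPerp`
(p642614) and `…CellLawVQSResp` (p643071).
* `rampLaplaceBound` — the body of `SlowGraphSketch.RampLaplaceBound` VERBATIM, BY NAME from ad-lit's `LatticeShear.integral_trapezoid_mul_exp_neg_le`
  (`QuasiStaticSlotWeight`, p636417); P2 `SlowGraphSketch.PairFactorisation` IS the landed `LatticeShear.integral_integral_mul_exp_pair_factor` (no copy).
* `Jmat ρ X B = ∫₀¹ a(u) e^{−XuB} du` — VERBATIM copy of `SlowGraphSketch.Jmat` (the Cruxes sketch is not importable), scalar version `JmatScalar ρ X a ≤ 1/(ρ(Xa)²)`;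
  the bilinear form of `Jmat` is the integral of the kernel's (`sum_sum_mul_Jmat_mul`) — symmetric for symmetric `B`, vanishing across an invariant
  hyperplane, PINCHED `J_X(b)|v|² ≤ vᵀJ_X(B)v ≤ J_X(a)|v|²` whenever the semigroup is (`sum_sum_mul_Jmat_mul_le` / `le_sum_sum_mul_Jmat_mul`, `X ≥ 0`).
* THE PAIR RESPONSE `(J_X(B) J_{X'}(B))_{ij} = ∫₀¹∫₀¹ a(u)a(u') (e^{−(Xu+X'u')B})_{ij}` (`Jmat_mul_Jmat_apply`, `Matrix.exp_add_of_commute`): the memory term of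
  `pairQS` — a product of two COMMUTING decreasing matrix functions of one block — is a non-negative mixture of the semigroup, hence pinched WITHOUT the
  spectral theorem, `J_X(b)J_{X'}(b)|v|² ≤ vᵀ J_X(B)J_{X'}(B) v ≤ J_X(a)J_{X'}(a)|v|²` (`sum_sum_mul_JmatPair_mul_le` / `le_sum_sum_mul_JmatPair_mul`), symmetric
  (`…_comm`), vanishing across an invariant hyperplane (`…_eq_zero`) — the `η = 0` case of STUB-IDEAS W1 («exact pinch when all `pairSign ≥ 0`»).
No named facts, no sorry.  Infrastructure for route-1's rung leaf F-D1.A0 (frontier FORMAL rung); NOT a proof of the stub, of the crux, of Onsager's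
conjecture or of anomalous dissipation.  Prover seat `ad-k1l-cellLawV-w1` g0, 2026-08-28.
-/

set_option linter.dupNamespace false

noncomputable section

namespace Summit.AnomalousDissipation.AnomalousDissipation.Theorems.SolenoidalFractalHomogenisation.LagrangianStep

open Literature.Analysis Literature.Analysis.FluidPDE Literature.Analysis.FunctionSpaces
open Literature.Analysis.ODE.PeriodicAveraging
open MeasureTheory Set

/-! ## §1 The scalar facts of the plan, by name (P1; P2 is already a Literature theorem) -/

section Scalar

/-- **(P1) `SlowGraphSketch.RampLaplaceBound`, VERBATIM body, PROVED** — the ramp transform is bounded by the initial ramp alone: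
`a(u) ≤ u/ρ` gives `J_X(1) = ∫₀¹ a(u)e^{−Xu}du ≤ 1/(ρX²)`.  By name from `LatticeShear.integral_trapezoid_mul_exp_neg_le` (slot length `τ = 1`);
the hypothesis `ρ ≤ 1/2` of the sketch is not needed. [folklore] -/
theorem rampLaplaceBound : ∀ ρ X : ℝ, 0 < ρ → ρ ≤ 1 / 2 → 0 < X →
    ∫ u in (0:ℝ)..1, LatticeShear.LatticeWord.trapezoid 0 1 ρ u * Real.exp (-(X * u)) ≤ 1 / (ρ * X ^ 2) := by
  intro ρ X hρ _ hX
  have h := LatticeShear.integral_trapezoid_mul_exp_neg_le (τ := 1) (ρ := ρ) (lam := X) one_pos hρ hX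
  simp only [mul_one, neg_mul] at h
  exact h

/- (P2) `SlowGraphSketch.PairFactorisation` needs no Theorems-side copy: its body is, token for token, the landed Literature theorem
`Literature.Analysis.FluidPDE.LatticeShear.integral_integral_mul_exp_pair_factor` (`QuasiStaticSlotWeight.lean`, ad-lit p636417) — cite that name
(a restatement here is refused by the gate as `dedup.landed`). -/

end Scalar
/-! ## §2 The ramp transform `Jmat` as a matrix function and its pinch -/

section Ramp

/-- The RAMP TRANSFORM `J_X(B) = ∫₀¹ a(u) e^{−XuB} du` of the unit slot envelope, as a matrix function: the sideband LEFT OVER at the end of a slot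
of non-dimensional relaxation `X` is `g·J_X(B)` times the slow amplitude, and the memory response of an adjacent equal-direction slot pair
FACTORISES as `J_{T_s}(B)·J_{T_{s'}}(B)`.  (VERBATIM copy of `Cruxes/LagrangianRenormalisationStep/SlowGraphSketch.lean` `Jmat`.) -/
def Jmat (ρ X : ℝ) (B : Matrix (Fin 3) (Fin 3) ℝ) : Matrix (Fin 3) (Fin 3) ℝ := fun i j =>
  ∫ u in (0:ℝ)..1, LatticeShear.LatticeWord.trapezoid 0 1 ρ u * (NormedSpace.exp (-(X * u) • B)) i j

/-- The SCALAR ramp transform `J_X(a) = ∫₀¹ a(u) e^{−Xua} du` (`Jmat` at the `1 × 1` block `a`; `J_X(a) = J_{Xa}(1)`). -/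
def JmatScalar (ρ X a : ℝ) : ℝ :=
  ∫ u in (0:ℝ)..1, LatticeShear.LatticeWord.trapezoid 0 1 ρ u * Real.exp (-(X * u) * a)

/-- `J_X(a) ≤ 1/(ρ (Xa)²)` for `Xa > 0` (P1 at relaxation `Xa`). [folklore] -/
theorem JmatScalar_le {ρ : ℝ} (hρ : 0 < ρ) (hρ2 : ρ ≤ 1 / 2) {X a : ℝ} (hXa : 0 < X * a) :
    JmatScalar ρ X a ≤ 1 / (ρ * (X * a) ^ 2) := by
  have e : ∀ u : ℝ, Real.exp (-(X * u) * a) = Real.exp (-(X * a * u)) := fun u => by congr 1; ring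
  simpa only [JmatScalar, e] using rampLaplaceBound ρ (X * a) hρ hρ2 hXa

/-- Continuity of the ramp kernel entries `u ↦ (e^{−XuB})ᵢⱼ`. [folklore] -/
theorem continuous_rampKernel_apply (X : ℝ) (B : Matrix (Fin 3) (Fin 3) ℝ) (i j : Fin 3) :
    Continuous fun u : ℝ => (NormedSpace.exp (-(X * u) • B)) i j :=
  (continuous_exp_smul_apply B i j).comp (by fun_prop : Continuous fun u : ℝ => -(X * u))

/-- Continuity of the bilinear form of the ramp kernel. [folklore] -/
theorem continuous_rampKernel_bilin (X : ℝ) (B : Matrix (Fin 3) (Fin 3) ℝ) (v w : Fin 3 → ℝ) :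
    Continuous fun u : ℝ => ∑ i, ∑ j, v i * (NormedSpace.exp (-(X * u) • B)) i j * w j :=
  continuous_finsetSum _ fun i _ => continuous_finsetSum _ fun j _ =>
    (continuous_const.mul (continuous_rampKernel_apply X B i j)).mul continuous_const

/-- Finite double sums with constant coefficients commute with the interval integral. [folklore] -/
private theorem integral_sum_sum_mul' {f : Fin 3 → Fin 3 → ℝ → ℝ} {a b : ℝ} (c : Fin 3 → Fin 3 → ℝ)
    (hf : ∀ i j, IntervalIntegrable (f i j) volume a b) :
    ∫ x in a..b, ∑ i, ∑ j, c i j * f i j x = ∑ i, ∑ j, c i j * ∫ x in a..b, f i j x := by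
  rw [intervalIntegral.integral_finsetSum]
  · refine Finset.sum_congr rfl fun i _ => ?_
    rw [intervalIntegral.integral_finsetSum]
    · exact Finset.sum_congr rfl fun j _ => intervalIntegral.integral_const_mul _ _
    · exact fun j _ => (hf i j).const_mul _
  · intro i _
    have h := IntervalIntegrable.sum Finset.univ fun j (_ : j ∈ Finset.univ) => (hf i j).const_mul (c i j)
    rw [Finset.sum_fn] at h
    exact h

/-- **The bilinear form of `Jmat` is the integral of the bilinear form of the kernel.** [folklore] -/
theorem sum_sum_mul_Jmat_mul (ρ X : ℝ) (B : Matrix (Fin 3) (Fin 3) ℝ) (v w : Fin 3 → ℝ) :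
    ∑ i, ∑ j, v i * Jmat ρ X B i j * w j =
      ∫ u in (0:ℝ)..1, LatticeShear.LatticeWord.trapezoid 0 1 ρ u *
        ∑ i, ∑ j, v i * (NormedSpace.exp (-(X * u) • B)) i j * w j := by
  have hin : ∀ i j, IntervalIntegrable (fun u => LatticeShear.LatticeWord.trapezoid 0 1 ρ u *
      (NormedSpace.exp (-(X * u) • B)) i j) volume 0 1 := fun i j =>
    ((continuous_trapezoid_unit ρ).mul (continuous_rampKernel_apply X B i j)).intervalIntegrable _ _
  rw [show (fun u => LatticeShear.LatticeWord.trapezoid 0 1 ρ u * ∑ i, ∑ j, v i * (NormedSpace.exp (-(X * u) • B)) i j * w j)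
      = fun u => ∑ i, ∑ j, (v i * w j) * (LatticeShear.LatticeWord.trapezoid 0 1 ρ u * (NormedSpace.exp (-(X * u) • B)) i j) by
    funext u
    rw [Finset.mul_sum]
    refine Finset.sum_congr rfl fun i _ => ?_
    rw [Finset.mul_sum]
    refine Finset.sum_congr rfl fun j _ => ?_
    ring]
  rw [integral_sum_sum_mul' (fun i j => v i * w j) hin]
  simp only [Jmat]
  refine Finset.sum_congr rfl fun i _ => Finset.sum_congr rfl fun j _ => ?_
  ring

/-- The bilinear form of `Jmat ρ X B` is SYMMETRIC for symmetric `B`. [folklore] -/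
theorem sum_sum_mul_Jmat_mul_comm (ρ X : ℝ) {B : Matrix (Fin 3) (Fin 3) ℝ} (hB : B.IsSymm) (v w : Fin 3 → ℝ) :
    ∑ i, ∑ j, v i * Jmat ρ X B i j * w j = ∑ i, ∑ j, w i * Jmat ρ X B i j * v j := by
  rw [sum_sum_mul_Jmat_mul, sum_sum_mul_Jmat_mul]
  refine intervalIntegral.integral_congr fun u _ => ?_
  congr 1
  rw [neg_smul, ← sum_mul_mulVec_eq_sum_sum, ← sum_mul_mulVec_eq_sum_sum]
  exact dotProduct_exp_neg_smul_mulVec_comm hB v w _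

/-- The bilinear form of `Jmat ρ X B` VANISHES across a hyperplane invariant under the semigroup. [folklore] -/
theorem sum_sum_mul_Jmat_mul_eq_zero (ρ X : ℝ) {B : Matrix (Fin 3) (Fin 3) ℝ} {u w : Fin 3 → ℝ}
    (h : ∀ τ : ℝ, ∑ i, u i * (NormedSpace.exp (-(τ • B))).mulVec w i = 0) :
    ∑ i, ∑ j, u i * Jmat ρ X B i j * w j = 0 := by
  rw [sum_sum_mul_Jmat_mul]
  have h0 : ∀ s : ℝ, ∑ i, ∑ j, u i * (NormedSpace.exp (-(X * s) • B)) i j * w j = 0 := by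
    intro s
    rw [neg_smul, ← sum_mul_mulVec_eq_sum_sum]
    exact h _
  simp only [h0, mul_zero, intervalIntegral.integral_zero]

/-- **The ramp pinch, upper half**: `vᵀe^{-τB}v ≤ e^{-aτ}|v|²` for `τ ≥ 0` gives `vᵀ J_X(B) v ≤ J_X(a)|v|²` (`X ≥ 0`). [folklore] -/
theorem sum_sum_mul_Jmat_mul_le {ρ X : ℝ} (hX : 0 ≤ X) {B : Matrix (Fin 3) (Fin 3) ℝ} {v : Fin 3 → ℝ} {a : ℝ}
    (hv : ∀ τ : ℝ, 0 ≤ τ → ∑ i, v i * (NormedSpace.exp (-(τ • B))).mulVec v i ≤ Real.exp (-(a * τ)) * ∑ i, v i ^ 2) :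
    ∑ i, ∑ j, v i * Jmat ρ X B i j * v j ≤ JmatScalar ρ X a * ∑ i, v i ^ 2 := by
  rw [sum_sum_mul_Jmat_mul]
  unfold JmatScalar
  rw [← intervalIntegral.integral_mul_const]
  refine intervalIntegral.integral_mono_on zero_le_one ?_ ?_ fun u hu => ?_
  · exact ((continuous_trapezoid_unit ρ).mul (continuous_rampKernel_bilin X B v v)).intervalIntegrable _ _
  · exact (((continuous_trapezoid_unit ρ).mul (by fun_prop)).mul continuous_const).intervalIntegrable _ _
  · rw [mul_assoc]
    refine mul_le_mul_of_nonneg_left ?_ (trapezoid_unit_nonneg ρ u)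
    have h := hv (X * u) (mul_nonneg hX hu.1)
    rw [neg_smul, ← sum_mul_mulVec_eq_sum_sum]
    rwa [show Real.exp (-(X * u) * a) = Real.exp (-(a * (X * u))) by congr 1; ring]

/-- **The ramp pinch, lower half**: `e^{-bτ}|v|² ≤ vᵀe^{-τB}v` for `τ ≥ 0` gives `J_X(b)|v|² ≤ vᵀ J_X(B) v` (`X ≥ 0`). [folklore] -/
theorem le_sum_sum_mul_Jmat_mul {ρ X : ℝ} (hX : 0 ≤ X) {B : Matrix (Fin 3) (Fin 3) ℝ} {v : Fin 3 → ℝ} {b : ℝ}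
    (hv : ∀ τ : ℝ, 0 ≤ τ → Real.exp (-(b * τ)) * ∑ i, v i ^ 2 ≤ ∑ i, v i * (NormedSpace.exp (-(τ • B))).mulVec v i) :
    JmatScalar ρ X b * ∑ i, v i ^ 2 ≤ ∑ i, ∑ j, v i * Jmat ρ X B i j * v j := by
  rw [sum_sum_mul_Jmat_mul]
  unfold JmatScalar
  rw [← intervalIntegral.integral_mul_const]
  refine intervalIntegral.integral_mono_on zero_le_one ?_ ?_ fun u hu => ?_
  · exact (((continuous_trapezoid_unit ρ).mul (by fun_prop)).mul continuous_const).intervalIntegrable _ _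
  · exact ((continuous_trapezoid_unit ρ).mul (continuous_rampKernel_bilin X B v v)).intervalIntegrable _ _
  · rw [mul_assoc]
    refine mul_le_mul_of_nonneg_left ?_ (trapezoid_unit_nonneg ρ u)
    have h := hv (X * u) (mul_nonneg hX hu.1)
    rw [neg_smul, ← sum_mul_mulVec_eq_sum_sum]
    rwa [show Real.exp (-(X * u) * b) = Real.exp (-(b * (X * u))) by congr 1; ring]

end Ramp
/-! ## §3 The pair response `J_X(B) J_{X'}(B)`: product formula and pinch -/

section Pair

/-- **Product formula**: `(J_X(B) J_{X'}(B))_{ij} = ∫₀¹ a(u) ∫₀¹ a(u') (e^{−(Xu + X'u')B})_{ij} du' du` (the semigroup property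
`e^{−XuB}e^{−X'u'B} = e^{−(Xu+X'u')B}`, `Matrix.exp_add_of_commute`). [folklore] -/
theorem Jmat_mul_Jmat_apply (ρ X X' : ℝ) (B : Matrix (Fin 3) (Fin 3) ℝ) (i j : Fin 3) :
    (Jmat ρ X B * Jmat ρ X' B) i j =
      ∫ u in (0:ℝ)..1, LatticeShear.LatticeWord.trapezoid 0 1 ρ u *
        ∫ u' in (0:ℝ)..1, LatticeShear.LatticeWord.trapezoid 0 1 ρ u' * (NormedSpace.exp (-(X * u + X' * u') • B)) i j := by
  -- the semigroup property, entrywise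
  have hexp : ∀ u u' : ℝ, (NormedSpace.exp (-(X * u + X' * u') • B)) i j
      = ∑ l, (NormedSpace.exp (-(X * u) • B)) i l * (NormedSpace.exp (-(X' * u') • B)) l j := by
    intro u u'
    have hc : Commute (-(X * u) • B) (-(X' * u') • B) :=
      ((Commute.refl B).smul_left _).smul_right _
    rw [show -(X * u + X' * u') • B = -(X * u) • B + -(X' * u') • B by rw [neg_add, add_smul],
      Matrix.exp_add_of_commute _ _ hc, Matrix.mul_apply]
  have hin : ∀ l, IntervalIntegrable (fun u' => LatticeShear.LatticeWord.trapezoid 0 1 ρ u' *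
      (NormedSpace.exp (-(X' * u') • B)) l j) volume 0 1 := fun l =>
    ((continuous_trapezoid_unit ρ).mul (continuous_rampKernel_apply X' B l j)).intervalIntegrable _ _
  have h1 : ∀ l, Jmat ρ X B i l * Jmat ρ X' B l j
      = ∫ u in (0:ℝ)..1, (LatticeShear.LatticeWord.trapezoid 0 1 ρ u * (NormedSpace.exp (-(X * u) • B)) i l) *
          (∫ u' in (0:ℝ)..1, LatticeShear.LatticeWord.trapezoid 0 1 ρ u' * (NormedSpace.exp (-(X' * u') • B)) l j) :=
    fun l => (intervalIntegral.integral_mul_const _ _).symm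
  rw [Matrix.mul_apply]
  simp only [h1]
  rw [← intervalIntegral.integral_finsetSum]
  · refine intervalIntegral.integral_congr fun u _ => ?_
    show ∑ l, (LatticeShear.LatticeWord.trapezoid 0 1 ρ u * (NormedSpace.exp (-(X * u) • B)) i l) *
        (∫ u' in (0:ℝ)..1, LatticeShear.LatticeWord.trapezoid 0 1 ρ u' * (NormedSpace.exp (-(X' * u') • B)) l j)
      = LatticeShear.LatticeWord.trapezoid 0 1 ρ u *
        ∫ u' in (0:ℝ)..1, LatticeShear.LatticeWord.trapezoid 0 1 ρ u' * (NormedSpace.exp (-(X * u + X' * u') • B)) i j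
    simp only [hexp]
    rw [show (fun u' => LatticeShear.LatticeWord.trapezoid 0 1 ρ u' *
          ∑ l, (NormedSpace.exp (-(X * u) • B)) i l * (NormedSpace.exp (-(X' * u') • B)) l j)
        = fun u' => ∑ l, (NormedSpace.exp (-(X * u) • B)) i l *
          (LatticeShear.LatticeWord.trapezoid 0 1 ρ u' * (NormedSpace.exp (-(X' * u') • B)) l j) by
      funext u'
      rw [Finset.mul_sum]
      exact Finset.sum_congr rfl fun l _ => by ring]
    rw [intervalIntegral.integral_finsetSum fun l _ => (hin l).const_mul _, Finset.mul_sum]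
    refine Finset.sum_congr rfl fun l _ => ?_
    rw [intervalIntegral.integral_const_mul]
    ring
  · intro l _
    exact (((continuous_trapezoid_unit ρ).mul (continuous_rampKernel_apply X B i l)).mul
      continuous_const).intervalIntegrable _ _

/-- Continuity of the pair kernel entries `(u, u') ↦ (e^{−(Xu+X'u')B})ᵢⱼ`. [folklore] -/
theorem continuous_pairKernel_apply (X X' : ℝ) (B : Matrix (Fin 3) (Fin 3) ℝ) (i j : Fin 3) :
    Continuous fun p : ℝ × ℝ => (NormedSpace.exp (-(X * p.1 + X' * p.2) • B)) i j :=
  (continuous_exp_smul_apply B i j).comp (by fun_prop : Continuous fun p : ℝ × ℝ => -(X * p.1 + X' * p.2))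

/-- Continuity of the bilinear form of the pair kernel. [folklore] -/
theorem continuous_pairKernel_bilin (X X' : ℝ) (B : Matrix (Fin 3) (Fin 3) ℝ) (v w : Fin 3 → ℝ) :
    Continuous fun p : ℝ × ℝ => ∑ i, ∑ j, v i * (NormedSpace.exp (-(X * p.1 + X' * p.2) • B)) i j * w j :=
  continuous_finsetSum _ fun i _ => continuous_finsetSum _ fun j _ =>
    (continuous_const.mul (continuous_pairKernel_apply X X' B i j)).mul continuous_const

/-- **The bilinear form of the pair response is the double integral of the bilinear form of the kernel.** [folklore] -/
theorem sum_sum_mul_JmatPair_mul (ρ X X' : ℝ) (B : Matrix (Fin 3) (Fin 3) ℝ) (v w : Fin 3 → ℝ) :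
    ∑ i, ∑ j, v i * (Jmat ρ X B * Jmat ρ X' B) i j * w j =
      ∫ u in (0:ℝ)..1, LatticeShear.LatticeWord.trapezoid 0 1 ρ u *
        ∫ u' in (0:ℝ)..1, LatticeShear.LatticeWord.trapezoid 0 1 ρ u' *
          ∑ i, ∑ j, v i * (NormedSpace.exp (-(X * u + X' * u') • B)) i j * w j := by
  set α : ℝ → ℝ := fun u => LatticeShear.LatticeWord.trapezoid 0 1 ρ u with hα
  set E : ℝ → ℝ → Fin 3 → Fin 3 → ℝ := fun u u' i j => (NormedSpace.exp (-(X * u + X' * u') • B)) i j with hE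
  have hin : ∀ i j u, IntervalIntegrable (fun u' => α u' * E u u' i j) volume 0 1 := fun i j u =>
    ((continuous_trapezoid_unit ρ).mul
      ((continuous_pairKernel_apply X X' B i j).comp (continuous_const.prodMk continuous_id))).intervalIntegrable _ _
  have hout : ∀ i j, IntervalIntegrable (fun u => α u * ∫ u' in (0:ℝ)..1, α u' * E u u' i j) volume 0 1 := by
    intro i j
    have hf : Continuous (Function.uncurry fun u u' : ℝ => α u' * E u u' i j) :=
      ((continuous_trapezoid_unit ρ).comp continuous_snd).mul (continuous_pairKernel_apply X X' B i j)
    exact ((continuous_trapezoid_unit ρ).mul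
      (intervalIntegral.continuous_parametric_intervalIntegral_of_continuous' hf 0 1)).intervalIntegrable _ _
  have hinner : ∀ u, ∫ u' in (0:ℝ)..1, α u' * ∑ i, ∑ j, v i * E u u' i j * w j
      = ∑ i, ∑ j, (v i * w j) * ∫ u' in (0:ℝ)..1, α u' * E u u' i j := by
    intro u
    rw [← integral_sum_sum_mul' (fun i j => v i * w j) fun i j => hin i j u]
    refine intervalIntegral.integral_congr fun u' _ => ?_
    show α u' * ∑ i, ∑ j, v i * E u u' i j * w j = ∑ i, ∑ j, (v i * w j) * (α u' * E u u' i j)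
    rw [Finset.mul_sum]
    refine Finset.sum_congr rfl fun i _ => ?_
    rw [Finset.mul_sum]
    refine Finset.sum_congr rfl fun j _ => ?_
    ring
  have houter : ∫ u in (0:ℝ)..1, α u * ∫ u' in (0:ℝ)..1, α u' * ∑ i, ∑ j, v i * E u u' i j * w j
      = ∑ i, ∑ j, (v i * w j) * ∫ u in (0:ℝ)..1, α u * ∫ u' in (0:ℝ)..1, α u' * E u u' i j := by
    rw [← integral_sum_sum_mul' (fun i j => v i * w j) hout]
    refine intervalIntegral.integral_congr fun u _ => ?_
    show α u * (∫ u' in (0:ℝ)..1, α u' * ∑ i, ∑ j, v i * E u u' i j * w j)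
      = ∑ i, ∑ j, (v i * w j) * (α u * ∫ u' in (0:ℝ)..1, α u' * E u u' i j)
    rw [hinner u, Finset.mul_sum]
    refine Finset.sum_congr rfl fun i _ => ?_
    rw [Finset.mul_sum]
    refine Finset.sum_congr rfl fun j _ => ?_
    ring
  rw [houter]
  refine Finset.sum_congr rfl fun i _ => Finset.sum_congr rfl fun j _ => ?_
  rw [Jmat_mul_Jmat_apply]
  ring

/-- The bilinear form of the pair response is SYMMETRIC for symmetric `B`. [folklore] -/
theorem sum_sum_mul_JmatPair_mul_comm (ρ X X' : ℝ) {B : Matrix (Fin 3) (Fin 3) ℝ} (hB : B.IsSymm) (v w : Fin 3 → ℝ) :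
    ∑ i, ∑ j, v i * (Jmat ρ X B * Jmat ρ X' B) i j * w j = ∑ i, ∑ j, w i * (Jmat ρ X B * Jmat ρ X' B) i j * v j := by
  rw [sum_sum_mul_JmatPair_mul, sum_sum_mul_JmatPair_mul]
  refine intervalIntegral.integral_congr fun u _ => ?_
  congr 1
  refine intervalIntegral.integral_congr fun u' _ => ?_
  congr 1
  rw [neg_smul, ← sum_mul_mulVec_eq_sum_sum, ← sum_mul_mulVec_eq_sum_sum]
  exact dotProduct_exp_neg_smul_mulVec_comm hB v w _

/-- The bilinear form of the pair response VANISHES across a hyperplane invariant under the semigroup. [folklore] -/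
theorem sum_sum_mul_JmatPair_mul_eq_zero (ρ X X' : ℝ) {B : Matrix (Fin 3) (Fin 3) ℝ} {u w : Fin 3 → ℝ}
    (h : ∀ τ : ℝ, ∑ i, u i * (NormedSpace.exp (-(τ • B))).mulVec w i = 0) :
    ∑ i, ∑ j, u i * (Jmat ρ X B * Jmat ρ X' B) i j * w j = 0 := by
  rw [sum_sum_mul_JmatPair_mul]
  have h0 : ∀ s s' : ℝ, ∑ i, ∑ j, u i * (NormedSpace.exp (-(X * s + X' * s') • B)) i j * w j = 0 := by
    intro s s'
    rw [neg_smul, ← sum_mul_mulVec_eq_sum_sum]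
    exact h _
  simp only [h0, mul_zero, intervalIntegral.integral_zero]

/-- The scalar pair weight as a double integral. [folklore] -/
private theorem JmatScalar_mul_JmatScalar (ρ X X' a c : ℝ) :
    JmatScalar ρ X a * JmatScalar ρ X' a * c =
      ∫ u in (0:ℝ)..1, LatticeShear.LatticeWord.trapezoid 0 1 ρ u *
        ∫ u' in (0:ℝ)..1, LatticeShear.LatticeWord.trapezoid 0 1 ρ u' *
          (Real.exp (-(a * (X * u + X' * u'))) * c) := by
  unfold JmatScalar
  set K : ℝ := (∫ u' in (0:ℝ)..1, LatticeShear.LatticeWord.trapezoid 0 1 ρ u' * Real.exp (-(X' * u') * a)) * c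
    with hK
  symm
  calc ∫ u in (0:ℝ)..1, LatticeShear.LatticeWord.trapezoid 0 1 ρ u *
        ∫ u' in (0:ℝ)..1, LatticeShear.LatticeWord.trapezoid 0 1 ρ u' * (Real.exp (-(a * (X * u + X' * u'))) * c)
      = ∫ u in (0:ℝ)..1, LatticeShear.LatticeWord.trapezoid 0 1 ρ u * (Real.exp (-(X * u) * a) * K) := by
        refine intervalIntegral.integral_congr fun u _ => ?_
        show _ = LatticeShear.LatticeWord.trapezoid 0 1 ρ u * (Real.exp (-(X * u) * a) * K)
        congr 1
        rw [hK, ← intervalIntegral.integral_mul_const, ← intervalIntegral.integral_const_mul]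
        refine intervalIntegral.integral_congr fun u' _ => ?_
        show LatticeShear.LatticeWord.trapezoid 0 1 ρ u' * (Real.exp (-(a * (X * u + X' * u'))) * c)
          = Real.exp (-(X * u) * a) * (LatticeShear.LatticeWord.trapezoid 0 1 ρ u' * Real.exp (-(X' * u') * a) * c)
        rw [show -(a * (X * u + X' * u')) = -(X * u) * a + -(X' * u') * a by ring, Real.exp_add]
        ring
    _ = (∫ u in (0:ℝ)..1, LatticeShear.LatticeWord.trapezoid 0 1 ρ u * Real.exp (-(X * u) * a)) * K := by
        rw [← intervalIntegral.integral_mul_const]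
        refine intervalIntegral.integral_congr fun u _ => ?_
        show LatticeShear.LatticeWord.trapezoid 0 1 ρ u * (Real.exp (-(X * u) * a) * K)
          = LatticeShear.LatticeWord.trapezoid 0 1 ρ u * Real.exp (-(X * u) * a) * K
        ring
    _ = _ := by rw [hK]; ring

/-- **The pair pinch, upper half**: `vᵀe^{-τB}v ≤ e^{-aτ}|v|²` (`τ ≥ 0`) gives `vᵀ J_X(B)J_{X'}(B) v ≤ J_X(a)J_{X'}(a)|v|²` (`X, X' ≥ 0`).
[folklore] -/
theorem sum_sum_mul_JmatPair_mul_le {ρ X X' : ℝ} (hX : 0 ≤ X) (hX' : 0 ≤ X') {B : Matrix (Fin 3) (Fin 3) ℝ} {v : Fin 3 → ℝ}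
    {a : ℝ} (hv : ∀ τ : ℝ, 0 ≤ τ → ∑ i, v i * (NormedSpace.exp (-(τ • B))).mulVec v i ≤ Real.exp (-(a * τ)) * ∑ i, v i ^ 2) :
    ∑ i, ∑ j, v i * (Jmat ρ X B * Jmat ρ X' B) i j * v j ≤ JmatScalar ρ X a * JmatScalar ρ X' a * ∑ i, v i ^ 2 := by
  rw [sum_sum_mul_JmatPair_mul, JmatScalar_mul_JmatScalar]
  have hsc : Continuous fun p : ℝ × ℝ => Real.exp (-(a * (X * p.1 + X' * p.2))) * ∑ i, v i ^ 2 := by fun_prop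
  refine intervalIntegral.integral_mono_on zero_le_one ?_ ?_ fun u hu => ?_
  · have hf : Continuous (Function.uncurry fun u u' : ℝ => LatticeShear.LatticeWord.trapezoid 0 1 ρ u' *
        ∑ i, ∑ j, v i * (NormedSpace.exp (-(X * u + X' * u') • B)) i j * v j) :=
      ((continuous_trapezoid_unit ρ).comp continuous_snd).mul (continuous_pairKernel_bilin X X' B v v)
    exact ((continuous_trapezoid_unit ρ).mul
      (intervalIntegral.continuous_parametric_intervalIntegral_of_continuous' hf 0 1)).intervalIntegrable _ _
  · have hf : Continuous (Function.uncurry fun u u' : ℝ => LatticeShear.LatticeWord.trapezoid 0 1 ρ u' *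
        (Real.exp (-(a * (X * u + X' * u'))) * ∑ i, v i ^ 2)) :=
      ((continuous_trapezoid_unit ρ).comp continuous_snd).mul hsc
    exact ((continuous_trapezoid_unit ρ).mul
      (intervalIntegral.continuous_parametric_intervalIntegral_of_continuous' hf 0 1)).intervalIntegrable _ _
  · refine mul_le_mul_of_nonneg_left ?_ (trapezoid_unit_nonneg ρ u)
    refine intervalIntegral.integral_mono_on zero_le_one ?_ ?_ fun u' hu' => ?_
    · exact ((continuous_trapezoid_unit ρ).mul
        ((continuous_pairKernel_bilin X X' B v v).comp (continuous_const.prodMk continuous_id))).intervalIntegrable _ _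
    · exact ((continuous_trapezoid_unit ρ).mul
        (hsc.comp (continuous_const.prodMk continuous_id))).intervalIntegrable _ _
    · refine mul_le_mul_of_nonneg_left ?_ (trapezoid_unit_nonneg ρ u')
      have hτ : 0 ≤ X * u + X' * u' := add_nonneg (mul_nonneg hX hu.1) (mul_nonneg hX' hu'.1)
      have h := hv (X * u + X' * u') hτ
      rw [neg_smul, ← sum_mul_mulVec_eq_sum_sum]
      exact h

/-- **The pair pinch, lower half**: `e^{-bτ}|v|² ≤ vᵀe^{-τB}v` (`τ ≥ 0`) gives `J_X(b)J_{X'}(b)|v|² ≤ vᵀ J_X(B)J_{X'}(B) v` (`X, X' ≥ 0`).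
[folklore] -/
theorem le_sum_sum_mul_JmatPair_mul {ρ X X' : ℝ} (hX : 0 ≤ X) (hX' : 0 ≤ X') {B : Matrix (Fin 3) (Fin 3) ℝ} {v : Fin 3 → ℝ}
    {b : ℝ} (hv : ∀ τ : ℝ, 0 ≤ τ → Real.exp (-(b * τ)) * ∑ i, v i ^ 2 ≤ ∑ i, v i * (NormedSpace.exp (-(τ • B))).mulVec v i) :
    JmatScalar ρ X b * JmatScalar ρ X' b * ∑ i, v i ^ 2 ≤ ∑ i, ∑ j, v i * (Jmat ρ X B * Jmat ρ X' B) i j * v j := by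
  rw [sum_sum_mul_JmatPair_mul, JmatScalar_mul_JmatScalar]
  have hsc : Continuous fun p : ℝ × ℝ => Real.exp (-(b * (X * p.1 + X' * p.2))) * ∑ i, v i ^ 2 := by fun_prop
  refine intervalIntegral.integral_mono_on zero_le_one ?_ ?_ fun u hu => ?_
  · have hf : Continuous (Function.uncurry fun u u' : ℝ => LatticeShear.LatticeWord.trapezoid 0 1 ρ u' *
        (Real.exp (-(b * (X * u + X' * u'))) * ∑ i, v i ^ 2)) :=
      ((continuous_trapezoid_unit ρ).comp continuous_snd).mul hsc
    exact ((continuous_trapezoid_unit ρ).mul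
      (intervalIntegral.continuous_parametric_intervalIntegral_of_continuous' hf 0 1)).intervalIntegrable _ _
  · have hf : Continuous (Function.uncurry fun u u' : ℝ => LatticeShear.LatticeWord.trapezoid 0 1 ρ u' *
        ∑ i, ∑ j, v i * (NormedSpace.exp (-(X * u + X' * u') • B)) i j * v j) :=
      ((continuous_trapezoid_unit ρ).comp continuous_snd).mul (continuous_pairKernel_bilin X X' B v v)
    exact ((continuous_trapezoid_unit ρ).mul
      (intervalIntegral.continuous_parametric_intervalIntegral_of_continuous' hf 0 1)).intervalIntegrable _ _
  · refine mul_le_mul_of_nonneg_left ?_ (trapezoid_unit_nonneg ρ u)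
    refine intervalIntegral.integral_mono_on zero_le_one ?_ ?_ fun u' hu' => ?_
    · exact ((continuous_trapezoid_unit ρ).mul
        (hsc.comp (continuous_const.prodMk continuous_id))).intervalIntegrable _ _
    · exact ((continuous_trapezoid_unit ρ).mul
        ((continuous_pairKernel_bilin X X' B v v).comp (continuous_const.prodMk continuous_id))).intervalIntegrable _ _
    · refine mul_le_mul_of_nonneg_left ?_ (trapezoid_unit_nonneg ρ u')
      have hτ : 0 ≤ X * u + X' * u' := add_nonneg (mul_nonneg hX hu.1) (mul_nonneg hX' hu'.1)
      have h := hv (X * u + X' * u') hτ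
      rw [neg_smul, ← sum_mul_mulVec_eq_sum_sum]
      exact h

end Pair

end Summit.AnomalousDissipation.AnomalousDissipation.Theorems.SolenoidalFractalHomogenisation.LagrangianStep

end
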